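import Summits.MatrixMultiplication.MatrixMultiplication.Theses.AsymptoticRankCW

/-!
# MatrixMultiplication / AsymptoticRankCW — `OmegaGeTwo` (lower frame `2 ≤ ω(ℂ)`)

Route `MatrixMultiplication/AsymptoticRankCW`, support item `stmt-MatrixMultiplication-0586`:
`admissibleExponents ℂ` is bounded below and `2 ≤ ω(ℂ)`.

Both conjuncts are proved Literature theorems
(`Literature/Computability/AlgebraicComplexity/FlatteningBound.lean`:
`admissibleExponents_bddBelow`, `omega_two_le`, any field), obtained from the flattening bound
`n² ≤ R(⟨n,n,n⟩)` and `n^{2-β} → ∞` for `β < 2` (Bläser 2013, §5–§6;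
Bürgisser–Clausen–Shokrollahi 1997, (15.3)). This file only records the route decl as settled.
-/

-- single-conjunct summit: the mandated namespace `Summit.MatrixMultiplication.MatrixMultiplication.…`
-- repeats `MatrixMultiplication` (summit = sub-problem), which `linter.dupNamespace` would flag.
set_option linter.dupNamespace false

namespace Summit.MatrixMultiplication.MatrixMultiplication.Theorems

/-- Settles item `stmt-MatrixMultiplication-0586` for route `AsymptoticRankCW`: the lower frame
`BddBelow (admissibleExponents ℂ) ∧ 2 ≤ ω(ℂ)`, from the flattening bound `R(⟨n,n,n⟩) ≥ n²`
(Bläser 2013, §5–§6), via the proved Literature theorems `admissibleExponents_bddBelow ℂ` and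
`omega_two_le ℂ`. -/
theorem omegaGeTwo_proof :
    Summit.MatrixMultiplication.MatrixMultiplication.Theses.AsymptoticRankCW.OmegaGeTwo := by
  unfold Summit.MatrixMultiplication.MatrixMultiplication.Theses.AsymptoticRankCW.OmegaGeTwo
  exact ⟨Literature.Computability.AlgebraicComplexity.admissibleExponents_bddBelow ℂ,
    Literature.Computability.AlgebraicComplexity.omega_two_le ℂ⟩

end Summit.MatrixMultiplication.MatrixMultiplication.Theorems
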